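import Literature.Geometry.Riemannian.BarrierMinimumPrinciple
import Literature.Geometry.Riemannian.HeatPropagationSpaceTime
import Literature.Geometry.Riemannian.HeatKernelMeasures
import Literature.MeasureTheory.Integral.IteratedIntegralDiracLimit
import Literature.Geometry.Riemannian.RicciFlowDistanceContinuity
import Literature.Topology.StoneWeierstrassProduct
import HarnessLib

/-!
# Bamler 2020a, Cor. 3.6 for two heat kernel measures, from the BARRIER form of the
# distance-distortion estimate (Thm. 3.5): `t ↦ ∫∫ d_t² dν_{x₁,t₀;t} dν_{x₂,t₀;t} + H t` is
# non-decreasing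

R. Bamler, *Entropy and heat kernel bounds on a Ricci flow background*, arXiv:2008.07093 (2020a),
Cor. 3.6, proof: solve `∂ₜu = (Δ_x + Δ_y) u` on `M × M × [t₁, t₂]` with `u(t₁) = d_{t₁}²`; by
Thm. 3.5 (barrier sense) and the maximum principle `d_t² − u + H (t − t₁) ≥ 0`; integrate
against `v₁ v₂` and use that `∫∫ u v₁ v₂` is constant. We run this for the heat kernel measures
`ν_{xᵢ,t₀;t}` (the case needed for Cor. 3.7 / `H`-concentration), with two simplifications that
avoid any regularity theory on `M × M`: the initial datum `d_{t₁}²` is replaced by a uniformly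
close finite sum `Σ αᵢ(x) βᵢ(y)` of SMOOTH products (Stone–Weierstrass,
`exists_sum_mul_near_continuous`, then smoothing of the factors), whose tensor heat flow
`U = Σ (P αᵢ)(x, t) (P βᵢ)(y, t)` (`heatValue`) is manifestly `C²` in each variable and solves
the equation exactly; and `∫∫ U(t₂) dν_{t₂} dν_{t₂} = ∫∫ U(t₁) dν_{t₁} dν_{t₁}` is the reproduction
formula `integral_heatKernelMeasure_trans`. The comparison is `barrier_minimum_principle`.

* `IsRicciFlow.kernel_integral_integral_distSq_sub_ge_of_barrier` — if `d_t²` admits, at every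
  `(x, y, t)` with `t ∈ (t₁, t₂]` and for every `η > 0`, an upper barrier with `C²` slices and
  `∂ₜb − Δ_x b − Δ_y b ≥ −H − η` at the point, then for `a < t₁ < t₂ < t₀ ≤ T`,
  `∫∫ d_{t₂}² dν_{x₂,t₀;t₂} dν_{x₁,t₀;t₂} − ∫∫ d_{t₁}² dν_{x₂,t₀;t₁} dν_{x₁,t₀;t₁} ≥ −H (t₂ − t₁)`.

The barrier property is a HYPOTHESIS here (Bamler's Thm. 3.5); everything else is proved; no
definitions, no named facts.

## References

* R. H. Bamler, *Entropy and heat kernel bounds on a Ricci flow background*, arXiv:2008.07093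
  (2020), §3, Thm. 3.5, Cor. 3.6. [Bamler2020Entropy]
-/

noncomputable section

open Bundle Set Function Filter Manifold MeasureTheory Measure TopologicalSpace
open scoped Manifold ContDiff Topology ENNReal NNReal

namespace Literature.Geometry.Riemannian

open Lorentzian Lorentzian.PseudoRiemannianMetric Literature.Topology

section Barrier

variable {m : ℕ} {H : Type*} [TopologicalSpace H]
  {I : ModelWithCorners ℝ (EuclideanSpace ℝ (Fin m)) H} [I.Boundaryless]
  {M : Type*} [TopologicalSpace M] [ChartedSpace H M] [IsManifold I ∞ M]
  [T2Space M] [CompactSpace M] [SecondCountableTopology M] [MeasurableSpace M] [BorelSpace M]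
  {h : ℝ → PseudoRiemannianMetric I ∞ (EuclideanSpace ℝ (Fin m)) (TangentSpace I : M → Type _)}
  (hh : IsContMDiffFamilyOn ∞ h univ) (hR : ∀ r, (h r).IsRiemannian)

omit [I.Boundaryless] [T2Space M] [CompactSpace M] [SecondCountableTopology M] [MeasurableSpace M]
  [BorelSpace M] in
/-- `Δ_g (Σᵢ cᵢ fᵢ) = Σᵢ cᵢ Δ_g fᵢ` at a point where the `fᵢ` are `C²`. [folklore] -/
theorem laplaceBeltrami_finset_sum_mul {ι : Type*} (s : Finset ι)
    (g : PseudoRiemannianMetric I ∞ (EuclideanSpace ℝ (Fin m)) (TangentSpace I : M → Type _))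
    {f : ι → M → ℝ} {x : M} (hf : ∀ i, ContMDiffAt I 𝓘(ℝ, ℝ) 2 (f i) x) (c : ι → ℝ) :
    g.laplaceBeltrami (fun y ↦ ∑ i ∈ s, c i * f i y) x = ∑ i ∈ s, c i * g.laplaceBeltrami (f i) x := by
  classical
  haveI := g.hasLeviCivita
  haveI : Fact (1 ≤ (∞ : ℕ∞ω)) := ⟨by exact_mod_cast le_top⟩
  induction s using Finset.induction_on with
  | empty => simp [laplaceBeltrami_const_fun]
  | @insert a s ha ih =>
    simp only [Finset.sum_insert ha]
    have hs : ContMDiffAt I 𝓘(ℝ, ℝ) 2 (fun y ↦ ∑ i ∈ s, c i * f i y) x :=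
      ContMDiffAt.sum fun i _ ↦ (contMDiffAt_const.mul (hf i) :
        ContMDiffAt I 𝓘(ℝ, ℝ) 2 (fun y ↦ c i * f i y) x)
    have h1 := g.dalembertian_add_const_mul_of_contMDiffAt hs (hf a) (c a)
    rw [laplaceBeltrami_eq_dalembertian, ← ih, laplaceBeltrami_eq_dalembertian,
      laplaceBeltrami_eq_dalembertian]
    rw [show (fun y ↦ c a * f a y + ∑ i ∈ s, c i * f i y) = fun y ↦ (∑ i ∈ s, c i * f i y) + c a * f a y
      from funext fun y ↦ add_comm _ _, h1]
    ring

omit [I.Boundaryless] [MeasurableSpace M] [BorelSpace M] [SecondCountableTopology M] in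
/-- **Smooth tensor approximation**: every continuous `f : M × M → ℝ` on a compact manifold is
uniformly approximated by finite sums `Σ αᵢ(x) βᵢ(y)` with SMOOTH `αᵢ, βᵢ` (Stone–Weierstrass
`exists_sum_mul_near_continuous`, then `exists_contMDiff_abs_sub_lt` on each factor). [folklore] -/
theorem exists_smooth_sum_mul_near {f : M × M → ℝ} (hf : Continuous f) {ε : ℝ} (hε : 0 < ε) :
    ∃ (n : ℕ) (α β : Fin n → M → ℝ), (∀ i, ContMDiff I 𝓘(ℝ, ℝ) ∞ (α i)) ∧
      (∀ i, ContMDiff I 𝓘(ℝ, ℝ) ∞ (β i)) ∧ ∀ p : M × M, |f p - ∑ i, α i p.1 * β i p.2| < ε := by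
  obtain ⟨n, α₀, β₀, h₀⟩ := exists_sum_mul_near_continuous hf (half_pos hε)
  -- a common bound for the factors
  set B : ℝ := 1 + ∑ i, (‖α₀ i‖ + ‖β₀ i‖) with hB
  have hB1 : 1 ≤ B := by
    have : 0 ≤ ∑ i, (‖α₀ i‖ + ‖β₀ i‖) := Finset.sum_nonneg fun i _ ↦ by positivity
    linarith
  have hαB : ∀ i x, |α₀ i x| ≤ B := fun i x ↦ by
    have h1 : |α₀ i x| ≤ ‖α₀ i‖ := by rw [← Real.norm_eq_abs]; exact (α₀ i).norm_coe_le_norm x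
    have h2 : ‖α₀ i‖ + ‖β₀ i‖ ≤ ∑ j, (‖α₀ j‖ + ‖β₀ j‖) :=
      Finset.single_le_sum (f := fun j ↦ ‖α₀ j‖ + ‖β₀ j‖) (fun j _ ↦ by positivity) (Finset.mem_univ i)
    linarith [norm_nonneg (β₀ i)]
  have hβB : ∀ i x, |β₀ i x| ≤ B := fun i x ↦ by
    have h1 : |β₀ i x| ≤ ‖β₀ i‖ := by rw [← Real.norm_eq_abs]; exact (β₀ i).norm_coe_le_norm x
    have h2 : ‖α₀ i‖ + ‖β₀ i‖ ≤ ∑ j, (‖α₀ j‖ + ‖β₀ j‖) :=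
      Finset.single_le_sum (f := fun j ↦ ‖α₀ j‖ + ‖β₀ j‖) (fun j _ ↦ by positivity) (Finset.mem_univ i)
    linarith [norm_nonneg (α₀ i)]
  -- the smoothing scale
  set δ : ℝ := min 1 (ε / (2 * ((n : ℝ) + 1) * (2 * B + 1))) with hδ
  have hδ0 : 0 < δ := by positivity
  have hδ1 : δ ≤ 1 := min_le_left _ _
  have hδ2 : δ ≤ ε / (2 * ((n : ℝ) + 1) * (2 * B + 1)) := min_le_right _ _
  have hα := fun i ↦ exists_contMDiff_abs_sub_lt (I := I) (α₀ i).continuous hδ0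
  have hβ := fun i ↦ exists_contMDiff_abs_sub_lt (I := I) (β₀ i).continuous hδ0
  choose α hαs hαδ using hα
  choose β hβs hβδ using hβ
  refine ⟨n, α, β, hαs, hβs, fun p ↦ ?_⟩
  -- termwise error
  have hterm : ∀ i, |α₀ i p.1 * β₀ i p.2 - α i p.1 * β i p.2| ≤ δ * (2 * B + 1) := by
    intro i
    have e : α₀ i p.1 * β₀ i p.2 - α i p.1 * β i p.2 =
        (α₀ i p.1 - α i p.1) * β₀ i p.2 + α i p.1 * (β₀ i p.2 - β i p.2) := by ring
    rw [e]
    have h1 : |α₀ i p.1 - α i p.1| < δ := by rw [abs_sub_comm]; exact hαδ i p.1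
    have h2 : |β₀ i p.2 - β i p.2| < δ := by rw [abs_sub_comm]; exact hβδ i p.2
    have h3 : |α i p.1| ≤ B + δ := by
      have := abs_sub_abs_le_abs_sub (α i p.1) (α₀ i p.1)
      rw [abs_sub_comm] at h1
      linarith [hαB i p.1]
    calc |(α₀ i p.1 - α i p.1) * β₀ i p.2 + α i p.1 * (β₀ i p.2 - β i p.2)|
        ≤ |α₀ i p.1 - α i p.1| * |β₀ i p.2| + |α i p.1| * |β₀ i p.2 - β i p.2| := by
          rw [← abs_mul, ← abs_mul]; exact abs_add_le _ _
      _ ≤ δ * B + (B + δ) * δ :=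
          add_le_add (mul_le_mul h1.le (hβB i p.2) (abs_nonneg _) hδ0.le)
            (mul_le_mul h3 h2.le (abs_nonneg _) (by linarith))
      _ = δ * (2 * B + δ) := by ring
      _ ≤ δ * (2 * B + 1) := by gcongr
  have hsum : |∑ i, α₀ i p.1 * β₀ i p.2 - ∑ i, α i p.1 * β i p.2| ≤ (n : ℝ) * (δ * (2 * B + 1)) := by
    rw [← Finset.sum_sub_distrib]
    refine (Finset.abs_sum_le_sum_abs _ _).trans ?_
    calc ∑ i, |α₀ i p.1 * β₀ i p.2 - α i p.1 * β i p.2| ≤ ∑ _i : Fin n, δ * (2 * B + 1) :=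
          Finset.sum_le_sum fun i _ ↦ hterm i
      _ = (n : ℝ) * (δ * (2 * B + 1)) := by simp
  have hsmall : (n : ℝ) * (δ * (2 * B + 1)) < ε / 2 := by
    have h1 : (n : ℝ) * (δ * (2 * B + 1)) ≤ (n : ℝ) * (ε / (2 * ((n : ℝ) + 1) * (2 * B + 1)) * (2 * B + 1)) := by
      gcongr
    have h2 : (n : ℝ) * (ε / (2 * ((n : ℝ) + 1) * (2 * B + 1)) * (2 * B + 1)) =
        ε / 2 * ((n : ℝ) / ((n : ℝ) + 1)) := by
      field_simp
    have h3 : (n : ℝ) / ((n : ℝ) + 1) < 1 := by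
      rw [div_lt_one (by positivity)]; linarith
    have h4 : ε / 2 * ((n : ℝ) / ((n : ℝ) + 1)) < ε / 2 * 1 := by gcongr
    linarith
  have h0p := h₀ p
  calc |f p - ∑ i, α i p.1 * β i p.2|
      = |(f p - ∑ i, α₀ i p.1 * β₀ i p.2) + (∑ i, α₀ i p.1 * β₀ i p.2 - ∑ i, α i p.1 * β i p.2)| := by
        ring_nf
    _ ≤ |f p - ∑ i, α₀ i p.1 * β₀ i p.2| + |∑ i, α₀ i p.1 * β₀ i p.2 - ∑ i, α i p.1 * β i p.2| :=
        abs_add_le _ _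
    _ < ε / 2 + ε / 2 := add_lt_add_of_lt_of_le h0p (hsum.trans hsmall.le)
    _ = ε := by ring

variable {cov : ℝ → CovariantDerivative I (EuclideanSpace ℝ (Fin m)) (TangentSpace I : M → Type _)}

/-- **Cor. 3.6 of Bamler 2020a for two heat kernel measures, from the barrier form of Thm. 3.5.**
For a `C^∞` family `h` of Riemannian metrics on a closed connected manifold which is a Ricci flow
on `[a, T]`, base time `t₀ ∈ (a, T]`, points `x₁, x₂`, and `a < t₁ < t₂ < t₀`: if at every
`(x, y, t)`, `t ∈ (t₁, t₂]`, and for every `η > 0` the function `d_t²(x, y)` admits an upper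
barrier near `(x, y, t)`, touching at the point, with `C²` slices and
`∂ₜb − Δ_x b − Δ_y b ≥ −H − η` there, then
`∫∫ d_{t₂}² dν_{x₂,t₀;t₂} dν_{x₁,t₀;t₂} − ∫∫ d_{t₁}² dν_{x₂,t₀;t₁} dν_{x₁,t₀;t₁} ≥ −H (t₂ − t₁)`.
[cite: Bamler2020Entropy, §3, Cor. 3.6] -/
theorem IsRicciFlow.kernel_integral_integral_distSq_sub_ge_of_barrier [ConnectedSpace M]
    {a T : ℝ} (hflow : IsRicciFlow h cov (Icc a T)) {t₀ : ℝ} (ht₀ : t₀ ∈ Ioc a T) (x₁ x₂ : M)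
    {t₁ t₂ : ℝ} (hat₁ : a < t₁) (h12 : t₁ < t₂) (h2 : t₂ < t₀) {Hc : ℝ}
    (hbar : ∀ x y, ∀ t ∈ Ioc t₁ t₂, ∀ η > 0, ∃ b : M → M → ℝ → ℝ,
      (∀ᶠ p in 𝓝 ((x, y, t) : M × M × ℝ),
        ((h p.2.2).edist (hR p.2.2) p.1 p.2.1).toReal ^ 2 ≤ b p.1 p.2.1 p.2.2) ∧
      b x y t = ((h t).edist (hR t) x y).toReal ^ 2 ∧
      (∀ᶠ x' in 𝓝 x, ContMDiffAt I 𝓘(ℝ, ℝ) 2 (fun x'' ↦ b x'' y t) x') ∧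
      (∀ᶠ y' in 𝓝 y, ContMDiffAt I 𝓘(ℝ, ℝ) 2 (fun y'' ↦ b x y'' t) y') ∧
      ∃ db : ℝ, HasDerivAt (fun s ↦ b x y s) db t ∧
        -Hc - η ≤ db - (h t).laplaceBeltrami (fun x' ↦ b x' y t) x -
          (h t).laplaceBeltrami (fun y' ↦ b x y' t) y) :
    -Hc * (t₂ - t₁) ≤
      (∫ y₁, ∫ y₂, ((h t₂).edist (hR t₂) y₁ y₂).toReal ^ 2 ∂(heatKernelMeasure hh hR t₀ x₂ t₂)
          ∂(heatKernelMeasure hh hR t₀ x₁ t₂)) -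
        ∫ y₁, ∫ y₂, ((h t₁).edist (hR t₁) y₁ y₂).toReal ^ 2 ∂(heatKernelMeasure hh hR t₀ x₂ t₁)
          ∂(heatKernelMeasure hh hR t₀ x₁ t₁) := by
  -- notation
  set d : M → M → ℝ → ℝ := fun x y t ↦ ((h t).edist (hR t) x y).toReal ^ 2 with hd
  set ν₁ : ℝ → Measure M := fun r ↦ heatKernelMeasure hh hR t₀ x₁ r with hν₁
  set ν₂ : ℝ → Measure M := fun r ↦ heatKernelMeasure hh hR t₀ x₂ r with hν₂
  haveI hP₁ : ∀ r, IsProbabilityMeasure (ν₁ r) := fun r ↦ by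
    simp only [hν₁]; infer_instance
  haveI hP₂ : ∀ r, IsProbabilityMeasure (ν₂ r) := fun r ↦ by
    simp only [hν₂]; infer_instance
  have hdc : ∀ r, Continuous fun q : M × M ↦ d q.1 q.2 r := fun r ↦
    (ENNReal.continuousOn_toReal.comp_continuous (PseudoRiemannianMetric.continuous_edist (hR r))
      fun p ↦ PseudoRiemannianMetric.edist_ne_top (hR r) p.1 p.2).pow 2
  have hflow' : IsRicciFlow h cov (Icc t₁ t₂) :=
    hflow.mono (Icc_subset_Icc hat₁.le (h2.le.trans ht₀.2))
  have hdcont : ContinuousOn (fun p : M × M × ℝ ↦ d p.1 p.2.1 p.2.2) (univ ×ˢ univ ×ˢ Icc t₁ t₂) :=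
    (hflow'.continuousOn_edist_toReal_family h12.le hR).pow 2
  -- integrability of continuous functions against the (probability) kernel measures
  have hint : ∀ {f : M → ℝ}, Continuous f → ∀ (ρ : Measure M) [IsFiniteMeasure ρ], Integrable f ρ :=
    fun hf ρ _ ↦ hf.integrable_of_hasCompactSupport (HasCompactSupport.of_compactSpace _)
  -- it suffices to prove the bound up to `2η` for every `η > 0`
  suffices hη : ∀ η > 0, -Hc * (t₂ - t₁) ≤ (∫ y₁, ∫ y₂, d y₁ y₂ t₂ ∂ν₂ t₂ ∂ν₁ t₂) -
      (∫ y₁, ∫ y₂, d y₁ y₂ t₁ ∂ν₂ t₁ ∂ν₁ t₁) + 2 * η by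
    refine le_of_forall_pos_le_add fun ε hε ↦ ?_
    have := hη (ε / 2) (half_pos hε)
    linarith
  intro η hη
  ----------------------------------------------------------------
  -- Step 1: smooth tensor approximation of `d_{t₁}²`
  ----------------------------------------------------------------
  obtain ⟨n, α, β, hαs, hβs, happrox⟩ := exists_smooth_sum_mul_near (I := I) (hdc t₁) hη
  ----------------------------------------------------------------
  -- Step 2: the tensor heat flow `U = Σ (P αᵢ)(x,t) (P βᵢ)(y,t)` from time `t₁`
  ----------------------------------------------------------------
  set A : Fin n → M → ℝ → ℝ := fun i x t ↦ heatValue h t₁ t x (α i) with hA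
  set B : Fin n → M → ℝ → ℝ := fun i y t ↦ heatValue h t₁ t y (β i) with hB
  set U : M → M → ℝ → ℝ := fun x y t ↦ ∑ i, A i x t * B i y t with hU
  -- regularity of the factors
  have hAs : ∀ i, ContMDiffOn (I.prod 𝓘(ℝ, ℝ)) 𝓘(ℝ, ℝ) ∞ (fun p : M × ℝ ↦ A i p.1 p.2) (univ ×ˢ Ici t₁) :=
    fun i ↦ contMDiffOn_heatValue_spaceTime hh hR t₁ (hαs i)
  have hBs : ∀ i, ContMDiffOn (I.prod 𝓘(ℝ, ℝ)) 𝓘(ℝ, ℝ) ∞ (fun p : M × ℝ ↦ B i p.1 p.2) (univ ×ˢ Ici t₁) :=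
    fun i ↦ contMDiffOn_heatValue_spaceTime hh hR t₁ (hβs i)
  have hAx : ∀ i, ∀ t ∈ Ici t₁, ContMDiff I 𝓘(ℝ, ℝ) ∞ fun x ↦ A i x t := fun i t ht ↦
    contMDiff_slice_of_contMDiffOn (u := fun t x ↦ A i x t) (hAs i) ht
  have hBy : ∀ i, ∀ t ∈ Ici t₁, ContMDiff I 𝓘(ℝ, ℝ) ∞ fun y ↦ B i y t := fun i t ht ↦
    contMDiff_slice_of_contMDiffOn (u := fun t y ↦ B i y t) (hBs i) ht
  have hAt : ∀ i x, ∀ t, t₁ < t → HasDerivAt (fun s ↦ A i x s)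
      ((h t).laplaceBeltrami (fun x' ↦ A i x' t) x) t := fun i x t ht ↦
    hasDerivAt_heatValue hh hR ht (hαs i) x
  have hBt : ∀ i y, ∀ t, t₁ < t → HasDerivAt (fun s ↦ B i y s)
      ((h t).laplaceBeltrami (fun y' ↦ B i y' t) y) t := fun i y t ht ↦
    hasDerivAt_heatValue hh hR ht (hβs i) y
  have h2le : (2 : ℕ∞ω) ≤ (∞ : ℕ∞ω) := WithTop.coe_le_coe.mpr le_top
  -- the hypotheses of the minimum principle for `U`
  have hUx : ∀ y, ∀ t ∈ Ioc t₁ t₂, ContMDiff I 𝓘(ℝ, ℝ) 2 fun x ↦ U x y t := by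
    intro y t ht
    have : ContMDiff I 𝓘(ℝ, ℝ) 2 fun x ↦ ∑ i ∈ Finset.univ, A i x t * B i y t :=
      ContMDiff.sum fun i _ ↦ (((hAx i t (le_of_lt ht.1)).of_le h2le).mul contMDiff_const :
        ContMDiff I 𝓘(ℝ, ℝ) 2 fun x ↦ A i x t * B i y t)
    simpa only [hU] using this
  have hUy : ∀ x, ∀ t ∈ Ioc t₁ t₂, ContMDiff I 𝓘(ℝ, ℝ) 2 fun y ↦ U x y t := by
    intro x t ht
    have : ContMDiff I 𝓘(ℝ, ℝ) 2 fun y ↦ ∑ i ∈ Finset.univ, A i x t * B i y t :=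
      ContMDiff.sum fun i _ ↦ (contMDiff_const.mul ((hBy i t (le_of_lt ht.1)).of_le h2le) :
        ContMDiff I 𝓘(ℝ, ℝ) 2 fun y ↦ A i x t * B i y t)
    simpa only [hU] using this
  have hLx : ∀ x y, ∀ t ∈ Ioc t₁ t₂, (h t).laplaceBeltrami (fun x' ↦ U x' y t) x =
      ∑ i, B i y t * (h t).laplaceBeltrami (fun x' ↦ A i x' t) x := by
    intro x y t ht
    have e : (fun x' ↦ U x' y t) = fun x' ↦ ∑ i, B i y t * A i x' t := by
      funext x'; simp only [hU]; exact Finset.sum_congr rfl fun i _ ↦ mul_comm _ _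
    rw [e]
    exact laplaceBeltrami_finset_sum_mul Finset.univ (h t)
      (fun i ↦ ((hAx i t (le_of_lt ht.1)).of_le h2le) x) _
  have hLy : ∀ x y, ∀ t ∈ Ioc t₁ t₂, (h t).laplaceBeltrami (fun y' ↦ U x y' t) y =
      ∑ i, A i x t * (h t).laplaceBeltrami (fun y' ↦ B i y' t) y := by
    intro x y t ht
    exact laplaceBeltrami_finset_sum_mul Finset.univ (h t)
      (fun i ↦ ((hBy i t (le_of_lt ht.1)).of_le h2le) y) _
  have hUt : ∀ x y, ∀ t ∈ Ioc t₁ t₂, HasDerivAt (fun s ↦ U x y s)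
      ((h t).laplaceBeltrami (fun x' ↦ U x' y t) x + (h t).laplaceBeltrami (fun y' ↦ U x y' t) y) t := by
    intro x y t ht
    rw [hLx x y t ht, hLy x y t ht, ← Finset.sum_add_distrib]
    have := HasDerivAt.fun_sum (u := Finset.univ) (A := fun i s ↦ A i x s * B i y s)
      (A' := fun i ↦ (h t).laplaceBeltrami (fun x' ↦ A i x' t) x * B i y t +
        A i x t * (h t).laplaceBeltrami (fun y' ↦ B i y' t) y) (x := t)
      fun i _ ↦ (hAt i x t ht.1).mul (hBt i y t ht.1)
    have e : ∑ i, (B i y t * (h t).laplaceBeltrami (fun x' ↦ A i x' t) x +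
        A i x t * (h t).laplaceBeltrami (fun y' ↦ B i y' t) y) =
        ∑ i, ((h t).laplaceBeltrami (fun x' ↦ A i x' t) x * B i y t +
          A i x t * (h t).laplaceBeltrami (fun y' ↦ B i y' t) y) :=
      Finset.sum_congr rfl fun i _ ↦ by ring
    rw [e]
    simpa only [hU] using this
  have hUc : ContinuousOn (fun p : M × M × ℝ ↦ U p.1 p.2.1 p.2.2) (univ ×ˢ univ ×ˢ Icc t₁ t₂) := by
    simp only [hU]
    refine continuousOn_finsetSum _ fun i _ ↦ ContinuousOn.mul ?_ ?_
    · exact (hAs i).continuousOn.comp (continuous_fst.prodMk (continuous_snd.comp continuous_snd)).continuousOn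
        fun p hp ↦ ⟨mem_univ _, hp.2.2.1⟩
    · exact (hBs i).continuousOn.comp ((continuous_fst.comp continuous_snd).prodMk
        (continuous_snd.comp continuous_snd)).continuousOn fun p hp ↦ ⟨mem_univ _, hp.2.2.1⟩
  have hU0 : ∀ x y, U x y t₁ = ∑ i, α i x * β i y := by
    intro x y
    simp only [hU, hA, hB, heatValue_of_le le_rfl]
  ----------------------------------------------------------------
  -- Step 3: the comparison `U ≤ d² + η + H (t − t₁)` (barrier minimum principle)
  ----------------------------------------------------------------
  have hcomp := barrier_minimum_principle (h := h) hR (ψ := fun x y t ↦ d x y t + η) (U := U)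
    (hdcont.add continuousOn_const) hUc hUx hUy hUt (c := Hc) ?_ ?_
  rotate_left
  · -- barriers for `d² + η`: shift the given barriers by `η`
    intro x y t ht η' hη'
    obtain ⟨b, hbd, hbeq, hbx, hby, db, hdb, hbineq⟩ := hbar x y t ht η' hη'
    refine ⟨fun x' y' t' ↦ b x' y' t' + η, ?_, by simp only [hbeq, hd], ?_, ?_, db, ?_, ?_⟩
    · filter_upwards [hbd] with p hp
      simp only [hd] at hp ⊢
      linarith
    · filter_upwards [hbx] with x' hx' using hx'.add contMDiffAt_const
    · filter_upwards [hby] with y' hy' using hy'.add contMDiffAt_const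
    · simpa using hdb.add_const η
    · haveI := (h t).hasLeviCivita
      haveI : Fact (1 ≤ (∞ : ℕ∞ω)) := ⟨by exact_mod_cast le_top⟩
      have ex : (h t).laplaceBeltrami (fun x' ↦ b x' y t + η) x = (h t).laplaceBeltrami (fun x' ↦ b x' y t) x := by
        have := (h t).dalembertian_add_const_mul_of_contMDiffAt hbx.self_of_nhds
          (contMDiffAt_const (c := (1 : ℝ))) η
        simp only [mul_one] at this
        rw [laplaceBeltrami_eq_dalembertian, laplaceBeltrami_eq_dalembertian, this,
          ← laplaceBeltrami_eq_dalembertian (h t) (fun _ ↦ (1 : ℝ)), laplaceBeltrami_const_fun]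
        ring
      have ey : (h t).laplaceBeltrami (fun y' ↦ b x y' t + η) y = (h t).laplaceBeltrami (fun y' ↦ b x y' t) y := by
        have := (h t).dalembertian_add_const_mul_of_contMDiffAt hby.self_of_nhds
          (contMDiffAt_const (c := (1 : ℝ))) η
        simp only [mul_one] at this
        rw [laplaceBeltrami_eq_dalembertian, laplaceBeltrami_eq_dalembertian, this,
          ← laplaceBeltrami_eq_dalembertian (h t) (fun _ ↦ (1 : ℝ)), laplaceBeltrami_const_fun]
        ring
      rw [ex, ey]; exact hbineq
  · -- initial comparison `U(t₁) = Σ αᵢ βᵢ ≤ d_{t₁}² + η`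
    intro x y
    rw [hU0]
    have := happrox (x, y)
    simp only [hd] at this ⊢
    linarith [(abs_lt.1 this).1]
  ----------------------------------------------------------------
  -- Step 4: integrate at time `t₂` and use the reproduction formula
  ----------------------------------------------------------------
  have ht₂ : t₂ ∈ Icc t₁ t₂ := right_mem_Icc.2 h12.le
  have ht₂' : t₂ ∈ Ioc t₁ t₂ := ⟨h12, le_rfl⟩
  -- `∫∫ U(t₂) dν₂ dν₁ ≤ ∫∫ d_{t₂}² dν₂ dν₁ + η + H (t₂ − t₁)`
  have hUle : ∀ x y, U x y t₂ ≤ d x y t₂ + (η + Hc * (t₂ - t₁)) := fun x y ↦ by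
    have := hcomp x y t₂ ht₂; linarith
  have hUc₂ : Continuous fun q : M × M ↦ U q.1 q.2 t₂ :=
    hUc.comp_continuous (continuous_fst.prodMk (continuous_snd.prodMk continuous_const))
      fun q ↦ ⟨mem_univ _, mem_univ _, ht₂⟩
  have hI1 : ∫ y₁, ∫ y₂, U y₁ y₂ t₂ ∂ν₂ t₂ ∂ν₁ t₂ ≤
      (∫ y₁, ∫ y₂, d y₁ y₂ t₂ ∂ν₂ t₂ ∂ν₁ t₂) + (η + Hc * (t₂ - t₁)) := by
    have inner : ∀ y₁, ∫ y₂, U y₁ y₂ t₂ ∂ν₂ t₂ ≤ (∫ y₂, d y₁ y₂ t₂ ∂ν₂ t₂) + (η + Hc * (t₂ - t₁)) := by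
      intro y₁
      have hId : Integrable (fun y₂ ↦ d y₁ y₂ t₂) (ν₂ t₂) :=
        hint ((hdc t₂).comp (Continuous.prodMk_right y₁)) _
      calc ∫ y₂, U y₁ y₂ t₂ ∂ν₂ t₂ ≤ ∫ y₂, d y₁ y₂ t₂ + (η + Hc * (t₂ - t₁)) ∂ν₂ t₂ :=
            integral_mono (hint (hUc₂.comp (Continuous.prodMk_right y₁)) _)
              (hId.add (integrable_const _)) fun y₂ ↦ hUle y₁ y₂
        _ = (∫ y₂, d y₁ y₂ t₂ ∂ν₂ t₂) + (η + Hc * (t₂ - t₁)) := by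
            rw [integral_add hId (integrable_const _), integral_const, probReal_univ, one_smul]
    have hG : Continuous fun y₁ ↦ ∫ y₂, d y₁ y₂ t₂ ∂ν₂ t₂ :=
      Literature.MeasureTheory.Integral.continuous_integral_of_continuous_prod (ν₂ t₂) (hdc t₂)
    have hGU : Continuous fun y₁ ↦ ∫ y₂, U y₁ y₂ t₂ ∂ν₂ t₂ :=
      Literature.MeasureTheory.Integral.continuous_integral_of_continuous_prod (ν₂ t₂) hUc₂
    calc ∫ y₁, ∫ y₂, U y₁ y₂ t₂ ∂ν₂ t₂ ∂ν₁ t₂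
        ≤ ∫ y₁, (∫ y₂, d y₁ y₂ t₂ ∂ν₂ t₂) + (η + Hc * (t₂ - t₁)) ∂ν₁ t₂ :=
          integral_mono (hint hGU _) ((hint hG _).add (integrable_const _)) inner
      _ = (∫ y₁, ∫ y₂, d y₁ y₂ t₂ ∂ν₂ t₂ ∂ν₁ t₂) + (η + Hc * (t₂ - t₁)) := by
          rw [integral_add (hint hG _) (integrable_const _), integral_const, probReal_univ, one_smul]
  -- `∫∫ U(t₂) dν₂(t₂) dν₁(t₂) = Σ (∫ αᵢ dν₁(t₁)) (∫ βᵢ dν₂(t₁))` (reproduction)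
  have hrepA : ∀ i, ∫ y, A i y t₂ ∂ν₁ t₂ = ∫ y, α i y ∂ν₁ t₁ := by
    intro i
    simp only [hA, hν₁]
    rw [integral_heatKernelMeasure_trans hh hR h12.le h2.le x₁ (hαs i).continuous]
    refine integral_congr_ae (Eventually.of_forall fun y ↦ ?_)
    simp only
    rw [integral_heatKernelMeasure hh hR h12 y (hαs i).continuous, heatValueC_eq_heatValue hh hR y (hαs i)]
  have hrepB : ∀ i, ∫ y, B i y t₂ ∂ν₂ t₂ = ∫ y, β i y ∂ν₂ t₁ := by
    intro i
    simp only [hB, hν₂]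
    rw [integral_heatKernelMeasure_trans hh hR h12.le h2.le x₂ (hβs i).continuous]
    refine integral_congr_ae (Eventually.of_forall fun y ↦ ?_)
    simp only
    rw [integral_heatKernelMeasure hh hR h12 y (hβs i).continuous, heatValueC_eq_heatValue hh hR y (hβs i)]
  have hAc : ∀ i, Continuous fun y ↦ A i y t₂ := fun i ↦ (hAx i t₂ h12.le).continuous
  have hBc : ∀ i, Continuous fun y ↦ B i y t₂ := fun i ↦ (hBy i t₂ h12.le).continuous
  have hI2 : ∫ y₁, ∫ y₂, U y₁ y₂ t₂ ∂ν₂ t₂ ∂ν₁ t₂ = ∑ i, (∫ y, α i y ∂ν₁ t₁) * ∫ y, β i y ∂ν₂ t₁ := by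
    have inner : ∀ y₁, ∫ y₂, U y₁ y₂ t₂ ∂ν₂ t₂ = ∑ i, A i y₁ t₂ * ∫ y, β i y ∂ν₂ t₁ := by
      intro y₁
      simp only [hU]
      rw [integral_finsetSum _ fun i _ ↦ (hint (hBc i) _).const_mul _]
      refine Finset.sum_congr rfl fun i _ ↦ ?_
      rw [integral_const_mul, hrepB i]
    simp_rw [inner]
    rw [integral_finsetSum _ fun i _ ↦ (hint (hAc i) _).mul_const _]
    refine Finset.sum_congr rfl fun i _ ↦ ?_
    rw [integral_mul_const, hrepA i]
  -- `Σ (∫ αᵢ dν₁(t₁)) (∫ βᵢ dν₂(t₁)) = ∫∫ Σ αᵢ βᵢ dν₂(t₁) dν₁(t₁) ≥ ∫∫ d_{t₁}² − η`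
  have hI3 : ∑ i, (∫ y, α i y ∂ν₁ t₁) * ∫ y, β i y ∂ν₂ t₁ =
      ∫ y₁, ∫ y₂, ∑ i, α i y₁ * β i y₂ ∂ν₂ t₁ ∂ν₁ t₁ := by
    have inner : ∀ y₁, ∫ y₂, ∑ i, α i y₁ * β i y₂ ∂ν₂ t₁ = ∑ i, α i y₁ * ∫ y, β i y ∂ν₂ t₁ := by
      intro y₁
      rw [integral_finsetSum _ fun i _ ↦ (hint (hβs i).continuous _).const_mul _]
      refine Finset.sum_congr rfl fun i _ ↦ ?_
      rw [integral_const_mul]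
    simp_rw [inner]
    rw [integral_finsetSum _ fun i _ ↦ (hint (hαs i).continuous _).mul_const _]
    refine Finset.sum_congr rfl fun i _ ↦ ?_
    rw [integral_mul_const]
  have hSc : Continuous fun q : M × M ↦ ∑ i, α i q.1 * β i q.2 :=
    continuous_finsetSum _ fun i _ ↦ ((hαs i).continuous.comp continuous_fst).mul
      ((hβs i).continuous.comp continuous_snd)
  have hI4 : (∫ y₁, ∫ y₂, d y₁ y₂ t₁ ∂ν₂ t₁ ∂ν₁ t₁) - η ≤
      ∫ y₁, ∫ y₂, ∑ i, α i y₁ * β i y₂ ∂ν₂ t₁ ∂ν₁ t₁ := by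
    have inner : ∀ y₁, (∫ y₂, d y₁ y₂ t₁ ∂ν₂ t₁) - η ≤ ∫ y₂, ∑ i, α i y₁ * β i y₂ ∂ν₂ t₁ := by
      intro y₁
      have hId : Integrable (fun y₂ ↦ d y₁ y₂ t₁) (ν₂ t₁) :=
        hint ((hdc t₁).comp (Continuous.prodMk_right y₁)) _
      calc (∫ y₂, d y₁ y₂ t₁ ∂ν₂ t₁) - η = ∫ y₂, d y₁ y₂ t₁ - η ∂ν₂ t₁ := by
            rw [integral_sub hId (integrable_const _), integral_const, probReal_univ, one_smul]
        _ ≤ ∫ y₂, ∑ i, α i y₁ * β i y₂ ∂ν₂ t₁ := by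
            refine integral_mono (hId.sub (integrable_const _))
              (hint (hSc.comp (Continuous.prodMk_right y₁)) _) fun y₂ ↦ ?_
            have := happrox (y₁, y₂)
            simp only [hd] at this ⊢
            linarith [(abs_lt.1 this).2]
    have hG : Continuous fun y₁ ↦ ∫ y₂, d y₁ y₂ t₁ ∂ν₂ t₁ :=
      Literature.MeasureTheory.Integral.continuous_integral_of_continuous_prod (ν₂ t₁) (hdc t₁)
    have hGS : Continuous fun y₁ ↦ ∫ y₂, ∑ i, α i y₁ * β i y₂ ∂ν₂ t₁ :=
      Literature.MeasureTheory.Integral.continuous_integral_of_continuous_prod (ν₂ t₁) hSc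
    calc (∫ y₁, ∫ y₂, d y₁ y₂ t₁ ∂ν₂ t₁ ∂ν₁ t₁) - η
        = ∫ y₁, (∫ y₂, d y₁ y₂ t₁ ∂ν₂ t₁) - η ∂ν₁ t₁ := by
          rw [integral_sub (hint hG _) (integrable_const _), integral_const, probReal_univ, one_smul]
      _ ≤ ∫ y₁, ∫ y₂, ∑ i, α i y₁ * β i y₂ ∂ν₂ t₁ ∂ν₁ t₁ :=
          integral_mono ((hint hG _).sub (integrable_const _)) (hint hGS _) inner
  -- assemble
  rw [hI2, hI3] at hI1
  linarith

end Barrier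

end Literature.Geometry.Riemannian

end
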